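import Literature.Computability.Cryptography.BLPRSReduction
import Literature.Computability.Cryptography.LWEHardnessProofs
import HarnessLib

/-!
# Classical hardness of LWE (BLPRS 2013, Thm. 1.1 = pqc.S21): the three remaining leaves, named
# (fact decomposition of `blprs_gapSVP_sqrt_dim_to_lwe_classical`, 2026-08-16)

Topic `Computability/Cryptography` (family `pqc`). `BLPRSReduction.lean` PROVES the paper's own
"formal statement of Theorem 1.1" (arXiv:1306.0281, §4, paragraph after Thm. 4.1, p. 13):
`blprs_gapSVP_sqrt_dim_to_lwe_classical_of_components h₁ h₂ h₃ h₄`, the named fact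
`Literature.Computability.Cryptography.blprs_gapSVP_sqrt_dim_to_lwe_classical q m` from four
printed components in machine form at the derived parameters `d = ⌊√n⌋`, `Q = 2^{⌊d/2⌋+2}`,
`α₁`, `α₂` of that file — `h₄` being the tree's pqc.S22 `regev_search_to_decision q`, which is
now a THEOREM (`regev_search_to_decision_holds`, `LWEHardnessProofs.lean`). The other three are
published theorems of three different papers, each a reduction in its own right and none a
restatement of Thm. 1.1 (each moves between two intermediate problems of the chain
`GapSVP_{⌊√n⌋} ← search-LWE_{d,Q,α₁} ← decision-LWE_{d,Q,α₂} ← decision-LWE_{n,q,α} ← search-LWE_{n,q,α}`):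

* `BLPRS2013.gapSVP_to_searchLWE_classical_smallDim q m` (= `h₁` verbatim) — **BLPRS Thm. 2.16,
  classical clause = Peikert 2009, Thm. 3.1** with `Q ≥ 2^{d/2}`: a search-`LWE_{d,Q,Ψ̄_{α₁}}`
  solver yields a classical `GapSVP` decider in dimension `d` for every admissible factor;
* `BLPRS2013.searchLWE_to_decisionLWE_powTwo_smallDim q m` (= `h₂` verbatim) — **BLPRS Thm. 2.17
  = Micciancio–Peikert 2012, Thm. 3.1** (search-to-decision for the power-of-two modulus `Q`,
  `α₂ = α₁(⌊log₂ n⌋+1)²`);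
* `BLPRS2013.decisionLWE_modulusDimensionSwitch q m` (= `h₃` verbatim) — **BLPRS §3–§4: Thm. 4.1
  with Cor. 3.2, Lemma 2.15 and Def. 2.11** (from a distinguisher for `LWE_{n,q,Ψ̄_α}` to one for
  `LWE_{d,Q,Ψ̄_{α₂}}`: modulus–dimension switching through binary-secret LWE).

and the assembly `blprs_gapSVP_sqrt_dim_to_lwe_classical_holds_of h₁ h₂ h₃` is PROVED (it is
`…_of_components` with `h₄ := regev_search_to_decision_holds q`). The discharge
`blprs_gapSVP_sqrt_dim_to_lwe_classical_holds` is that theorem applied to the three `_holds` once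
they land; the tree's `LWEPrimePower*` files (Micciancio–Peikert's digit-by-digit search-to-decision)
and `LWEBinary*` / `LWEModulusSwitch*` / `ExtLWE*` files (BLPRS §3–§4) are the work in progress on
the second and third. All statements use the vocabulary and parameter bookkeeping of
`BLPRSReduction.lean` (`dim`, `modulus`, `rate₁`, `rate₂`, `SolvesSmallDimSearch`,
`DistinguishesSmallDim`, `DecidesGapSVPSqrtDim`), quantified over the noise rate `α` under the
hypotheses of pqc.S21 with `k = 1`, exactly as the components are consumed there.
-- TODO(general form): each child is the special case, at the BLPRS parameter choice, of the cited
-- theorem for general `(n, q, α)`; a general vendoring would state Peikert 2009 Thm. 3.1 and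
-- Micciancio–Peikert 2012 Thm. 3.1 over arbitrary polynomially bounded parameter sequences.

## References

* Z. Brakerski, A. Langlois, C. Peikert, O. Regev, D. Stehlé, *Classical hardness of learning with
  errors*, STOC 2013, 575–584; arXiv:1306.0281: Thm. 1.1, Def. 2.11, Lemma 2.15, Thm. 2.16,
  Thm. 2.17, Cor. 3.2, Thm. 4.1 and the paragraph following it (p. 13). [BrakerskiEtAl2013]
* C. Peikert, *Public-key cryptosystems from the worst-case shortest vector problem*, STOC 2009,
  §3, Thm. 3.1. [Peikert2009]
* D. Micciancio, C. Peikert, *Trapdoors for lattices: simpler, tighter, faster, smaller*,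
  EUROCRYPT 2012, LNCS 7237, 700–718, Thm. 3.1. [MicciancioPeikert2012]
* O. Regev, *On lattices, learning with errors, random linear codes, and cryptography*, J. ACM 56
  (2009), §4. [RegevLWE2009]
-/

noncomputable section

open Filter Asymptotics Computability Literature.Computability.Complexity
  Literature.Computability.Cryptography.LWE Literature.Algebra.EuclideanLattices
  Literature.Computability.Cryptography
open scoped ENNReal

namespace Literature.Computability.Cryptography

namespace BLPRS2013

variable (q : ℕ → ℕ) [∀ n, NeZero (q n)] (m : ℕ → ℕ)

/-- **BLPRS 2013, Thm. 2.16, classical clause (= Peikert 2009, Thm. 3.1, for `q ≥ 2^{n/2}`), in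
the machine form consumed by `blprs_gapSVP_sqrt_dim_to_lwe_classical_of_components` (its
hypothesis `h₁`, verbatim).** PRINTED: "Let `n, q ≥ 1` be integers and let `α ∈ (0,1)` be such
that `αq ≥ 2√n`. Then there exists a quantum reduction from worst-case `n`-dimensional
`GapSVP_{Õ(n/α)}` to `LWE_{n,q,α}`. If in addition `q ≥ 2^{n/2}` then there is also a classical
reduction between those problems" (Peikert's admissible factor being `γ ≥ n/(α√(log n))`).
MACHINE FORM, at dimension `d = ⌊√n⌋` (`dim`), modulus `Q = 2^{⌊d/2⌋+2} ≥ 2^{d/2}` (`modulus`) and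
rate `α₁` (`rate₁`), for every noise rate `α` under the hypotheses of pqc.S21 with `k = 1` (`q`,
`m` polynomially bounded, `IsPolyTimeParams q α m`, `α(n) ∈ (0,1)` and `αq ≥ √n log n`
eventually): for every factor `g(n)` eventually `≥ 2d/(α₁√(log d))` and every probabilistic
polynomial-time oracle algorithm `R` using a polynomially bounded, polynomial-time computable
number `m₁(n)` of samples there is a probabilistic polynomial-time `M` such that, for every oracle
`O`, if `R^O` solves search-`LWE_{d,Q,Ψ̄_{α₁}}` with average-case probability `≥ 2/3`
(`SolvesSmallDimSearch`) then `M^O` decides `GapSVP` in dimension `d` with factor `g(n)`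
(`DecidesGapSVPSqrtDim`). Users take `(h : gapSVP_to_searchLWE_classical_smallDim q m)`.
[cite: BrakerskiEtAl2013, Thm. 2.16 (classical clause) and p. 13] [cite: Peikert2009, §3, Thm. 3.1] -/
def gapSVP_to_searchLWE_classical_smallDim : Prop :=
  ∀ (α : ℕ → ℝ) (_ : IsPolyBounded q) (_ : IsPolyBounded m) (_ : IsPolyTimeParams q α m)
    (_ : ∀ᶠ n : ℕ in atTop, 0 < α n ∧ α n < 1 ∧ Real.sqrt n * Real.log n ≤ α n * q n)
    (g : ℕ → ℝ),
    (∀ᶠ n : ℕ in atTop, 2 * (dim n : ℝ) / (rate₁ α n * Real.sqrt (Real.log (dim n))) ≤ g n) →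
    ∀ (R : OracleAlg (List Bool)) (coinsR fuelR : Polynomial ℕ) (m₁ : ℕ → ℕ),
      R.IsPolyTime (encodingList Bool) → IsPolyBounded m₁ →
      PolyTimeComputable unaryEncodeNat encodeNat m₁ →
      ∃ (M : OracleAlg Bool) (coins fuel : Polynomial ℕ), M.IsPolyTime encodingBoolBool ∧
        ∀ O : Oracle, SolvesSmallDimSearch α R O coinsR fuelR m₁ → DecidesGapSVPSqrtDim g M O coins fuel

/-- **BLPRS 2013, Thm. 2.17 (special case of Micciancio–Peikert 2012, Thm. 3.1: search-to-decision
for a power-of-two modulus), in the machine form consumed by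
`blprs_gapSVP_sqrt_dim_to_lwe_classical_of_components` (its hypothesis `h₂`, verbatim).** PRINTED:
"Let `q` be a power of `2`, and `α` satisfy `1/q < α < 1/ω(√(log n))`. Then there exists an
efficient reduction from search `LWE_{n,q,α}` to (decision) `LWE_{n,q,α'}` for
`α' = α · ω(log n)`." MACHINE FORM at `(d, Q, α₁, α₂ = α₁(⌊log₂ n⌋+1)²)` (`dim`, `modulus`, `rate₁`,
`rate₂`), for every noise rate `α` under the hypotheses of pqc.S21 with `k = 1`: every
probabilistic polynomial-time distinguisher `D` for `LWE_{d,Q,Ψ̄_{α₂}}` with advantage `≥ 1/n^c` on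
a polynomially bounded, polynomial-time computable number `m₂(n)` of samples
(`DistinguishesSmallDim`) yields a probabilistic polynomial-time solver for
search-`LWE_{d,Q,Ψ̄_{α₁}}` with `m₁(n)` samples (`SolvesSmallDimSearch`), uniformly in the oracle
`O` both are run with. Users take `(h : searchLWE_to_decisionLWE_powTwo_smallDim q m)`.
[cite: BrakerskiEtAl2013, Thm. 2.17 and p. 13] [cite: MicciancioPeikert2012, Thm. 3.1] -/
def searchLWE_to_decisionLWE_powTwo_smallDim : Prop :=
  ∀ (α : ℕ → ℝ) (_ : IsPolyBounded q) (_ : IsPolyBounded m) (_ : IsPolyTimeParams q α m)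
    (_ : ∀ᶠ n : ℕ in atTop, 0 < α n ∧ α n < 1 ∧ Real.sqrt n * Real.log n ≤ α n * q n)
    (D : OracleAlg Bool) (coinsD fuelD : Polynomial ℕ) (m₂ : ℕ → ℕ) (c : ℕ),
      D.IsPolyTime encodingBoolBool → IsPolyBounded m₂ →
      PolyTimeComputable unaryEncodeNat encodeNat m₂ →
      ∃ (R : OracleAlg (List Bool)) (coinsR fuelR : Polynomial ℕ) (m₁ : ℕ → ℕ),
        R.IsPolyTime (encodingList Bool) ∧ IsPolyBounded m₁ ∧
        PolyTimeComputable unaryEncodeNat encodeNat m₁ ∧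
        ∀ O : Oracle, DistinguishesSmallDim α D O coinsD fuelD m₂ c →
          SolvesSmallDimSearch α R O coinsR fuelR m₁

/-- **BLPRS 2013, §3–§4 — Thm. 4.1 with Cor. 3.2, Lemma 2.15 and Def. 2.11 (modulus–dimension
switching), in the machine form consumed by `blprs_gapSVP_sqrt_dim_to_lwe_classical_of_components`
(its hypothesis `h₃`, verbatim).** PRINTED (p. 13): "By combining Theorem 4.1 with the reduction in
Corollary 3.2 (and noting that `{0,1}ⁿ` is `(√n, 0)`-bounded), we can replace the `binLWE` problem
above with `binLWE_{n,m,q',β}` for any `q' ≥ 1` and `ξ > 0` where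
`β = (10nα² + (4n/(πq'²)) ln(2n(1+1/ξ)))^{1/2}`, while decreasing the advantage by `14ξm`", with
"(Strictly speaking, one also needs to apply Lemma 2.15 to replace the 'unknown noise' variant of
LWE given by Corollary 3.2 with the fixed noise variant.)" and the random self-reduction of
Def. 2.11. MACHINE FORM, for every noise rate `α` under the hypotheses of pqc.S21 with `k = 1`:
every probabilistic polynomial-time distinguisher `D₃` for `LWE_{n,q,Ψ̄_α}` with advantage
`≥ 1/n^c` on a polynomially bounded number `m₃(n)` of samples (`DecisionLWEDistinguishes` of the
tree, for the oracle distinguisher `oracleLWEDistinguisher D₃ O …`) yields a probabilistic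
polynomial-time distinguisher `D` for `LWE_{d,Q,Ψ̄_{α₂}}`, `d = ⌊√n⌋`, `Q = 2^{⌊d/2⌋+2}`,
`α₂ = rate₂ α`, with advantage `≥ 1/n^{c'}` on a polynomially bounded, polynomial-time computable
number `m₂(n)` of samples (`DistinguishesSmallDim`). Users take
`(h : decisionLWE_modulusDimensionSwitch q m)`.
[cite: BrakerskiEtAl2013, Thm. 4.1, Cor. 3.2, Lemma 2.15, Def. 2.11 and p. 13] -/
def decisionLWE_modulusDimensionSwitch : Prop :=
  ∀ (α : ℕ → ℝ) (_ : IsPolyBounded q) (_ : IsPolyBounded m) (_ : IsPolyTimeParams q α m)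
    (_ : ∀ᶠ n : ℕ in atTop, 0 < α n ∧ α n < 1 ∧ Real.sqrt n * Real.log n ≤ α n * q n)
    (D₃ : OracleAlg Bool) (coins₃ fuel₃ : Polynomial ℕ) (m₃ : ℕ → ℕ) (c : ℕ),
      D₃.IsPolyTime encodingBoolBool → IsPolyBounded m₃ →
      ∃ (D : OracleAlg Bool) (coinsD fuelD : Polynomial ℕ) (m₂ : ℕ → ℕ) (c' : ℕ),
        D.IsPolyTime encodingBoolBool ∧ IsPolyBounded m₂ ∧
        PolyTimeComputable unaryEncodeNat encodeNat m₂ ∧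
        ∀ O : Oracle,
          DecisionLWEDistinguishes q (fun n => discretizedGaussian (q n) (α n)) m₃
            (fun n => oracleLWEDistinguisher D₃ O coins₃ fuel₃ n (q n) (m₃ n))
            (fun n => 1 / (n : ℝ) ^ c) →
          DistinguishesSmallDim α D O coinsD fuelD m₂ c'

end BLPRS2013

open BLPRS2013

section Assembly

variable (q : ℕ → ℕ) [∀ n, NeZero (q n)] (m : ℕ → ℕ)

/-- **pqc.S21 (BLPRS 2013, Thm. 1.1) from its three remaining leaves** — the assembly of the
decomposition: `blprs_gapSVP_sqrt_dim_to_lwe_classical_of_components` (the paper's "formal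
statement of Theorem 1.1", p. 13, PROVED in `BLPRSReduction.lean`) with its fourth component,
pqc.S22 `regev_search_to_decision q`, discharged by `regev_search_to_decision_holds`. Once the
three leaves are theorems, `blprs_gapSVP_sqrt_dim_to_lwe_classical_holds q m` is this theorem
applied to their `_holds`.
[cite: BrakerskiEtAl2013, Thm. 1.1 via Thms. 2.16, 2.17, 4.1, Cor. 3.2, Lemma 2.15 (p. 13)] -/
theorem blprs_gapSVP_sqrt_dim_to_lwe_classical_holds_of
    (h₁ : gapSVP_to_searchLWE_classical_smallDim q m)
    (h₂ : searchLWE_to_decisionLWE_powTwo_smallDim q m)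
    (h₃ : decisionLWE_modulusDimensionSwitch q m) :
    blprs_gapSVP_sqrt_dim_to_lwe_classical q m :=
  blprs_gapSVP_sqrt_dim_to_lwe_classical_of_components q m h₁ h₂ h₃
    (regev_search_to_decision_holds q)

end Assembly

end Literature.Computability.Cryptography

end
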